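import Literature.Analysis.FluidPDE.AxisymmetricL3OffAxis
import Literature.Analysis.FluidPDE.AxisymmetricL3Infinity
import HarnessLib

/-!
# Boundedness off a tube around the axis near the final time — without a Type I assumption

Analysis/FluidPDE proofs-layer file on the discharge path of
`Literature.Analysis.FluidPDE.LeiZhang2011_regularity_bmoStream` (Lei–Zhang 2011, Thm. 1.4): the
hypothesis (H2) of `LeiZhang2011_regularity_classical_local` — the velocity is bounded on
`(T₁, T) × {r(x) ≥ ρ}` — for axisymmetric Leray–Hopf solutions which are classical below the
final time (`AxisymmetricL3Hyp`), glued by compactness from the two partial-regularity inputs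
proved without a Type I assumption: every point `(T, x₀)` off the axis is a point of local
boundedness (`axisymmetricL3_boundedNearTop_offAxis`; Caffarelli–Kohn–Nirenberg / Seregin's
backward criterion) and `u` is bounded near the final time outside a large ball
(`axisymmetricL3_boundedNearTop_infinity`; the one-scale criterion on far cylinders).

* `exists_bound_final_slab_offTube` — the compactness glue on `closedBall 0 R ∩ {r(x) ≥ ρ}`
  (cf. `exists_bound_final_slab`);
* `AxisymmetricL3Hyp.bounded_offTube` — (H2): for every `ρ > 0` there are `r₀ > 0` and `M₀` with
  `‖u t x‖ ≤ M₀` for `T − r₀² < t < T`, `r(x) ≥ ρ`.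

## References

* L. Caffarelli, R. Kohn, L. Nirenberg, Comm. Pure Appl. Math. 35 (1982). [CaffarelliKohnNirenberg1982]
* G. Seregin, V. Šverák, Comm. PDE 34 (2009) = arXiv:0804.1803, §3 (p. 9: "all singular points
  must belong to the axis of symmetry"). [SereginSverak2009]
* Z. Lei, Q. S. Zhang, J. Funct. Anal. 261 (2011) = arXiv:1011.5066, Thm. 1.4. [LeiZhang2011]
-/

noncomputable section

open MeasureTheory Set Function Filter Topology TopologicalSpace Metric
open scoped NNReal ENNReal

namespace Literature.Analysis.FluidPDE

/-- Local notation for physical space `ℝ³ = EuclideanSpace ℝ (Fin 3)`. -/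
local notation "ℝ³" => EuclideanSpace ℝ (Fin 3)

section Glue

variable {T : ℝ} {u : ℝ → ℝ³ → ℝ³}

/-- **Local boundedness at the points of the final time off a tube plus boundedness near
infinity give boundedness off the tube on a final slab**: cover the compact
`closedBall 0 R ∩ {r(x) ≥ ρ}` by finitely many balls of local boundedness and take the least
radius and the largest bound (cf. `exists_bound_final_slab`). [folklore] -/
theorem exists_bound_final_slab_offTube {ρ : ℝ}
    (hloc : ∀ x₀ : ℝ³, ρ ≤ cylRadius x₀ → IsBoundedNearTop u T x₀) {R r₁ K₁ : ℝ}
    (hr₁ : 0 < r₁) (hfar : ∀ t ∈ Ioo (T - r₁ ^ 2) T, ∀ x : ℝ³, R ≤ ‖x‖ → ‖u t x‖ ≤ K₁) :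
    ∃ r₀ > 0, ∃ K : ℝ, ∀ t ∈ Ioo (T - r₀ ^ 2) T, ∀ x, ρ ≤ cylRadius x → ‖u t x‖ ≤ K := by
  have hloc' : ∀ i : {x : ℝ³ // ρ ≤ cylRadius x}, IsBoundedNearTop u T (i : ℝ³) :=
    fun i => hloc i i.2
  choose r hr K hK using hloc'
  -- the compact set and its finite subcover
  set S : Set ℝ³ := closedBall (0 : ℝ³) R ∩ {x | ρ ≤ cylRadius x} with hS
  have hSc : IsCompact S :=
    (isCompact_closedBall (0 : ℝ³) R).inter_right
      (isClosed_le continuous_const continuous_cylRadius)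
  obtain ⟨s, hs⟩ := hSc.elim_finite_subcover
    (fun i : {x : ℝ³ // ρ ≤ cylRadius x} => ball (i : ℝ³) (r i)) (fun _ => isOpen_ball)
    (fun x hx => mem_iUnion.2 ⟨⟨x, hx.2⟩, mem_ball_self (hr _)⟩)
  -- least radius, largest bound
  set radii : Finset ℝ := insert r₁ (s.image r) with hradii
  set bounds : Finset ℝ := insert K₁ (s.image K) with hbounds
  have hne : radii.Nonempty := Finset.insert_nonempty _ _
  have hneb : bounds.Nonempty := Finset.insert_nonempty _ _
  set r₀ : ℝ := radii.min' hne with hr₀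
  set K₀ : ℝ := bounds.max' hneb with hK₀
  have hr₀pos : 0 < r₀ := by
    rw [hr₀, Finset.lt_min'_iff]
    intro y hy
    rw [hradii, Finset.mem_insert, Finset.mem_image] at hy
    rcases hy with rfl | ⟨x₀, -, rfl⟩
    · exact hr₁
    · exact hr x₀
  have hr₀r₁ : r₀ ≤ r₁ := Finset.min'_le _ _ (Finset.mem_insert_self _ _)
  have hr₀r : ∀ x₀ ∈ s, r₀ ≤ r x₀ := fun x₀ hx₀ =>
    Finset.min'_le _ _ (Finset.mem_insert_of_mem (Finset.mem_image_of_mem r hx₀))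
  have hK₁K₀ : K₁ ≤ K₀ := Finset.le_max' _ _ (Finset.mem_insert_self _ _)
  have hKK₀ : ∀ x₀ ∈ s, K x₀ ≤ K₀ := fun x₀ hx₀ =>
    Finset.le_max' _ _ (Finset.mem_insert_of_mem (Finset.mem_image_of_mem K hx₀))
  refine ⟨r₀, hr₀pos, K₀, fun t ht x hxρ => ?_⟩
  by_cases hxR : R ≤ ‖x‖
  · have ht₁ : t ∈ Ioo (T - r₁ ^ 2) T :=
      ⟨by nlinarith [ht.1, pow_le_pow_left₀ hr₀pos.le hr₀r₁ 2], ht.2⟩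
    exact (hfar t ht₁ x hxR).trans hK₁K₀
  · have hxS : x ∈ S := by
      refine ⟨?_, hxρ⟩
      rw [mem_closedBall, dist_zero_right]
      exact (not_le.1 hxR).le
    obtain ⟨x₀, hx₀s, hxx₀⟩ : ∃ x₀ ∈ s, x ∈ ball (x₀ : ℝ³) (r x₀) := by
      simpa only [mem_iUnion, exists_prop] using hs hxS
    have htx₀ : t ∈ Ioo (T - r x₀ ^ 2) T :=
      ⟨by nlinarith [ht.1, pow_le_pow_left₀ hr₀pos.le (hr₀r x₀ hx₀s) 2], ht.2⟩
    exact (hK x₀ t htx₀ x hxx₀).trans (hKK₀ x₀ hx₀s)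

end Glue

namespace AxisymmetricL3Hyp

variable {ν T : ℝ} {u : ℝ → ℝ³ → ℝ³} {p : ℝ → ℝ³ → ℝ}

/-- **(H2): boundedness off a tube around the axis near the final time, without a Type I
assumption.** Under `AxisymmetricL3Hyp ν T u p`, for every `ρ > 0` there are `r₀ > 0` and `M₀`
with `‖u t x‖ ≤ M₀` for `T − r₀² < t < T` and `r(x) ≥ ρ`: off-axis points of the final time are
points of local boundedness (`axisymmetricL3_boundedNearTop_offAxis`), `u` is bounded near the
final time outside a large ball (`axisymmetricL3_boundedNearTop_infinity`), and the rest is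
compactness (`exists_bound_final_slab_offTube`).
[cite: SereginSverak2009, §3 (arXiv p. 9); CaffarelliKohnNirenberg1982, Prop. 1, Cor. 1 and Thm. B] -/
theorem bounded_offTube (H : AxisymmetricL3Hyp ν T u p) {ρ : ℝ} (hρ : 0 < ρ) :
    ∃ r₀ > 0, ∃ M₀ : ℝ, ∀ t ∈ Ioo (T - r₀ ^ 2) T, ∀ x, ρ ≤ cylRadius x → ‖u t x‖ ≤ M₀ := by
  obtain ⟨R, r₁, K₁, hr₁, hfar⟩ := axisymmetricL3_boundedNearTop_infinity H
  exact exists_bound_final_slab_offTube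
    (fun x₀ hx₀ => axisymmetricL3_boundedNearTop_offAxis H x₀ (lt_of_lt_of_le hρ hx₀).ne')
    hr₁ hfar

end AxisymmetricL3Hyp

end Literature.Analysis.FluidPDE

end
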